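import Summits.CriticalPhenomena.PercolationContinuityZ3.Theorems.PercNearOneGluingNoHeavyLowerTailSahiC4CubeEvents
import Summits.CriticalPhenomena.PercolationContinuityZ3.Theorems.PercNearOneGluingNoHeavyLowerTailSahiC3CubeColourCheck

/-!
# Sahi's `C₄` on the cube `{0,1}^m` by 4-COLOURED ANTICHAINS, I: a kernel-checkable certificate over the saturated quadruples with the
# colourings up to relabelling (restricted growth) — the checker, its assembly from chunks, and its completeness

Support file (cell `prim-sahi`, seat `prim-sahi-typer` gen 28; `--supports stmt-CriticalPhenomena-4575`).  No `sorry`; the checker is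
computable and nothing is evaluated here (the evaluation at `m = 5` lives in separate COMPUTATIONAL files; the bridge to events and measures is
part II, …`SahiC4CubeColourEvents`; the assembly is …`SahiC4CubeFive`).

The order-4 analogue of …`SahiC3CubeColourCheck`.  Sahi's `C₄(μ_p)` — `E₄(A,B,C,D) ≥ 0` for increasing events of `{0,1}^m` under a product
measure — is, by the VALUE-LEVEL SATURATION REDUCTION `SahiAbsorbed.sahiPositive_of_colouring` (given `C₁, C₂, C₃(μ_p)`), decided on the
quadruples CO-GENERATED BY A 4-COLOURED ANTICHAIN `N` of the cube, `U_i = {S | ∀ T ∈ N, c T = i → ¬ S ⊆ T}`.  Two further reductions are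
built into the checker and undone in its soundness proof:
* colourings are enumerated up to the relabelling group `S₄` (restricted growth: the colour of a newly added point is at most the number of
  colours used so far) — `E₄` is symmetric (`sahiE_comp_perm`), so every colouring is a relabelling of an enumerated one;
* a leaf at which some colour class is empty (`U_i` = the whole cube) is accepted without a test — `E₄(·,·,·,Ω) = 2E₃` (`sahiE4_univ`) and
  `C₃(μ_p)` is a hypothesis of part II.
At `m = 5`: `Σ_N 4^{|N|} = 31 346 385` coloured antichains, `1 384 548` restricted-growth leaves, `703 905` digit tests (prim-masterthm-p3's
four-copy tensor-Bernstein test `SahiC4Cube.checkQuadW`, base `2^26`, here in the Horner form `checkQuadH` with shared Kronecker numbers;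
≈ 1.7 ms each on the farm).

* `zE4h`, `checkQuadH`, `zE4h_eq`, `checkQuadH_eq` — the certificate number of `E₄` in Horner form (`= zE4`, `= checkQuadW`);
* `downMask4`, `leafT4`, `goC4`, `brC4`, `colourCheck4 m σ` — the checker (computable);
* `goC4_of_chain`, `brTop`, `brSnd`, `sndCol0/1`, `colourCheck4_of_brTop`, `brTop_of_brSnd`, `brSnd_of_sndCol` — assembly of a state of `goC4`
  from the branch terms `brC4` along its skip chain, at depth one and two (how the computational chunks are glued);
* **`goC4_sound`**, `leafT4_of_colourCheck4` — completeness of the recursion up to a relabelling `π ∈ S₄` of the colours fixing the colours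
  already used. [this work]
-/

namespace Summit.CriticalPhenomena.PercolationContinuityZ3.Theorems.SahiC4Cube

open Finset MeasureTheory OneCutCert CovTransferCert FourCopyCert SahiC3Cube
open Literature.Combinatorics.Sahi2008
open Literature.Probability.LatticeModels (prodBernoulli sahiE3 sahiE4 sahiE4_univ sahiE4_comm₁₂)
open Literature.Probability.Percolation
open Literature.Probability.Percolation.DecisionTree (ind ind_nonneg)

/-! ## The certificate number in Horner form -/

/-- The certificate number of `E₄(A,B,C,D)` with the fifteen Kronecker numbers shared and the powers of the full-cube number `F` collected
(Horner): `((6K(ABCD)F − 2ΣK(A)K(BCD) − ΣK(AB)K(CD))·F + ΣK(A)K(B)K(CD))·F − K(A)K(B)K(C)K(D)`. [this work] -/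
def zE4h (σ m : ℕ) (F : ℤ) (A B C D : ℕ) : ℤ :=
  let kA : ℤ := krT5 σ m A
  let kB : ℤ := krT5 σ m B
  let kC : ℤ := krT5 σ m C
  let kD : ℤ := krT5 σ m D
  let kAB : ℤ := krT5 σ m (A &&& B)
  let kAC : ℤ := krT5 σ m (A &&& C)
  let kAD : ℤ := krT5 σ m (A &&& D)
  let kBC : ℤ := krT5 σ m (B &&& C)
  let kBD : ℤ := krT5 σ m (B &&& D)
  let kCD : ℤ := krT5 σ m (C &&& D)
  let kABC : ℤ := krT5 σ m (A &&& B &&& C)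
  let kABD : ℤ := krT5 σ m (A &&& B &&& D)
  let kACD : ℤ := krT5 σ m (A &&& C &&& D)
  let kBCD : ℤ := krT5 σ m (B &&& C &&& D)
  let kABCD : ℤ := krT5 σ m (A &&& B &&& C &&& D)
  let i1 : ℤ := 6 * kABCD * F - 2 * (kA * kBCD + kB * kACD + kC * kABD + kD * kABC) - (kAB * kCD + kAC * kBD + kAD * kBC)
  let i2 : ℤ := i1 * F + (kA * kB * kCD + kA * kC * kBD + kA * kD * kBC + kB * kC * kAD + kB * kD * kAC + kC * kD * kAB)
  i2 * F - kA * kB * kC * kD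

/-- `zE4h = zE4`. [this work] -/
theorem zE4h_eq (σ m : ℕ) (F : ℤ) (A B C D : ℕ) : zE4h σ m F A B C D = zE4 σ m F A B C D := by
  unfold zE4h zE4
  ring

/-- The digit test of one quadruple, Horner form (`= checkQuadW`). [this work] -/
def checkQuadH (σ m : ℕ) (F off : ℤ) (offN : ℕ) (A B C D : ℕ) : Bool :=
  let Z := zE4h σ m F A B C D + off
  decide (0 ≤ Z) && decide ((Z.toNat &&& offN) = offN)

/-- `checkQuadH = checkQuadW`. [this work] -/
theorem checkQuadH_eq (σ m : ℕ) (F off : ℤ) (offN : ℕ) (A B C D : ℕ) :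
    checkQuadH σ m F off offN A B C D = checkQuadW σ m F off offN A B C D := by
  unfold checkQuadH checkQuadW
  rw [zE4h_eq]

/-! ## Coloured down-masks (four colours) -/

/-- The down-mask generated by the points of colour `i` of a 4-coloured point set. [this work] -/
def downMask4 (m : ℕ) (E : Finset ℕ) (c : ℕ → Fin 4) (i : Fin 4) : ℕ :=
  ofBits (fun x => decide (∃ t ∈ E, c t = i ∧ x &&& t = x)) (2 ^ m)

/-- Bits of `downMask4`. [this work] -/
theorem testBit_downMask4 (m : ℕ) (E : Finset ℕ) (c : ℕ → Fin 4) (i : Fin 4) (x : ℕ) :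
    (downMask4 m E c i).testBit x = (decide (x < 2 ^ m) && decide (∃ t ∈ E, c t = i ∧ x &&& t = x)) := by
  unfold downMask4; rw [testBit_ofBits]

/-- The empty coloured set generates nothing. [this work] -/
theorem lor_downMask4_empty (m d : ℕ) (c : ℕ → Fin 4) (i : Fin 4) : d ||| downMask4 m ∅ c i = d := by
  refine Nat.eq_of_testBit_eq fun x => ?_
  simp [testBit_downMask4]

/-- Removing a point of another colour does not change the down-mask of colour `i`. [this work] -/
theorem downMask4_erase_of_ne (m : ℕ) (E : Finset ℕ) (c : ℕ → Fin 4) {q : ℕ} {i : Fin 4} (hi : c q ≠ i) :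
    downMask4 m (E.erase q) c i = downMask4 m E c i := by
  refine Nat.eq_of_testBit_eq fun x => ?_
  rw [testBit_downMask4, testBit_downMask4]
  congr 1
  refine Bool.decide_congr ⟨?_, ?_⟩
  · rintro ⟨t, ht, hct, hxt⟩
    exact ⟨t, (mem_erase.1 ht).2, hct, hxt⟩
  · rintro ⟨t, ht, hct, hxt⟩
    refine ⟨t, mem_erase.2 ⟨?_, ht⟩, hct, hxt⟩
    rintro rfl
    exact hi hct

/-- Adding the point `q` of colour `c q` by hand (mask level): `d ||| ↓q ||| downMask (E ∖ q) = d ||| downMask E` in colour `c q`. [this work] -/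
theorem lor_belowN_lor_downMask4_erase (m d : ℕ) (E : Finset ℕ) (c : ℕ → Fin 4) {q : ℕ} (hq : q ∈ E) :
    d ||| belowN m q ||| downMask4 m (E.erase q) c (c q) = d ||| downMask4 m E c (c q) := by
  refine Nat.eq_of_testBit_eq fun x => ?_
  simp only [Nat.testBit_lor, testBit_belowN, testBit_downMask4]
  by_cases hx : x < 2 ^ m
  · simp only [hx, decide_true, Bool.true_and]
    cases hd : d.testBit x
    · simp only [Bool.false_or]
      rw [← Bool.decide_or]
      refine Bool.decide_congr ⟨?_, ?_⟩
      · rintro (hxq | ⟨t, ht, hct, hxt⟩)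
        · exact ⟨q, hq, rfl, hxq⟩
        · exact ⟨t, (mem_erase.1 ht).2, hct, hxt⟩
      · rintro ⟨t, ht, hct, hxt⟩
        by_cases htq : t = q
        · subst htq; exact Or.inl hxt
        · exact Or.inr ⟨t, mem_erase.2 ⟨htq, ht⟩, hct, hxt⟩
    · simp
  · simp [hx]

/-- The update of the four masks when `q` receives colour `i₀`, read at colour `i`, joined with the rest of the coloured set. [this work] -/
theorem step_mask4 (m d : ℕ) (E : Finset ℕ) (c : ℕ → Fin 4) {q : ℕ} (hq : q ∈ E) (i₀ i : Fin 4) (hc : c q = i₀) :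
    (if i₀ = i then d ||| belowN m q else d) ||| downMask4 m (E.erase q) c i = d ||| downMask4 m E c i := by
  split_ifs with h
  · subst h; subst hc
    exact lor_belowN_lor_downMask4_erase m d E c hq
  · rw [downMask4_erase_of_ne m E c (by rw [hc]; exact h)]

/-! ## The checker -/

/-- A LEAF of the search: the four down-masks `d_i` of the colour classes.  Accepted if some class is empty (`d_i = 0`: the member is the whole
cube and `E₄ = 2E₃`), else the digit test on the four members `memN m d_i`. [this work] -/
def leafT4 (σ m : ℕ) (F off : ℤ) (offN : ℕ) (d0 d1 d2 d3 : ℕ) : Bool :=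
  decide (d0 = 0 ∨ d1 = 0 ∨ d2 = 0 ∨ d3 = 0) ||
    checkQuadH σ m F off offN (memN m d0) (memN m d1) (memN m d2) (memN m d3)

/-- Include/exclude recursion over the points `q, q+1, …, 2^m − 1` (`fuel` left) with the comparability cones of the chosen points as exclusion
mask `forb`, the number `nc` of colours used so far, and the four down-masks; a newly chosen point gets a colour `≤ nc` (restricted growth).
[this work] -/
def goC4 (σ m : ℕ) (F off : ℤ) (offN : ℕ) : ℕ → ℕ → ℕ → ℕ → ℕ → ℕ → ℕ → ℕ → Bool
  | 0, _, _, _, d0, d1, d2, d3 => leafT4 σ m F off offN d0 d1 d2 d3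
  | fuel + 1, q, forb, nc, d0, d1, d2, d3 =>
      goC4 σ m F off offN fuel (q + 1) forb nc d0 d1 d2 d3 &&
        (forb.testBit q ||
          (goC4 σ m F off offN fuel (q + 1) (forb ||| coneN m q) (max nc 1) (d0 ||| belowN m q) d1 d2 d3 &&
            (decide (nc < 1) || goC4 σ m F off offN fuel (q + 1) (forb ||| coneN m q) (max nc 2) d0 (d1 ||| belowN m q) d2 d3) &&
            (decide (nc < 2) || goC4 σ m F off offN fuel (q + 1) (forb ||| coneN m q) (max nc 3) d0 d1 (d2 ||| belowN m q) d3) &&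
            (decide (nc < 3) || goC4 σ m F off offN fuel (q + 1) (forb ||| coneN m q) (max nc 4) d0 d1 d2 (d3 ||| belowN m q))))

/-- The BRANCH TERM of `goC4` at the point `q` (fuel recomputed as `2^m − (q+1)`): the conjunction of the explored colour branches.  The
computational chunks evaluate lists of these. [this work] -/
def brC4 (σ m : ℕ) (F off : ℤ) (offN : ℕ) (q forb nc d0 d1 d2 d3 : ℕ) : Bool :=
  goC4 σ m F off offN (2 ^ m - (q + 1)) (q + 1) (forb ||| coneN m q) (max nc 1) (d0 ||| belowN m q) d1 d2 d3 &&
    (decide (nc < 1) || goC4 σ m F off offN (2 ^ m - (q + 1)) (q + 1) (forb ||| coneN m q) (max nc 2) d0 (d1 ||| belowN m q) d2 d3) &&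
    (decide (nc < 2) || goC4 σ m F off offN (2 ^ m - (q + 1)) (q + 1) (forb ||| coneN m q) (max nc 3) d0 d1 (d2 ||| belowN m q) d3) &&
    (decide (nc < 3) || goC4 σ m F off offN (2 ^ m - (q + 1)) (q + 1) (forb ||| coneN m q) (max nc 4) d0 d1 d2 (d3 ||| belowN m q))

/-- **The 4-coloured-antichain check of the `m`-cube in base `2^σ`**: the coefficient bound of `checkQuad` and the search from the empty state.
[this work] -/
def colourCheck4 (m σ : ℕ) : Bool :=
  decide (0 < σ) && decide (24 * 16 ^ m < 2 ^ (σ - 1)) &&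
    goC4 σ m (krT5 σ m (fullN m)) (offM σ m) (offM σ m).toNat (2 ^ m) 0 0 0 0 0 0 0

/-! ## Assembly along the skip chain -/

/-- **A state of `goC4` from its branch terms**: if every point `q' ∈ [q, 2^m)` outside `forb` has a passing branch term and the leaf of the
unchanged state passes, the state passes. [this work] -/
theorem goC4_of_chain (σ m : ℕ) (F off : ℤ) (offN : ℕ) (forb nc d0 d1 d2 d3 : ℕ) :
    ∀ (fuel q : ℕ), q + fuel = 2 ^ m →
      (∀ q', q ≤ q' → q' < 2 ^ m → forb.testBit q' = false → brC4 σ m F off offN q' forb nc d0 d1 d2 d3 = true) →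
      leafT4 σ m F off offN d0 d1 d2 d3 = true →
      goC4 σ m F off offN fuel q forb nc d0 d1 d2 d3 = true := by
  intro fuel
  induction fuel with
  | zero => intro q _ _ hleaf; exact hleaf
  | succ fuel ih =>
    intro q hq hch hleaf
    show (goC4 σ m F off offN fuel (q + 1) forb nc d0 d1 d2 d3 && (forb.testBit q || _)) = true
    rw [Bool.and_eq_true]
    refine ⟨ih (q + 1) (by omega) (fun q' h1 h2 h3 => hch q' (by omega) h2 h3) hleaf, ?_⟩
    rw [Bool.or_eq_true]
    cases hf : forb.testBit q
    · right
      have hc := hch q le_rfl (by omega) hf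
      have e : 2 ^ m - (q + 1) = fuel := by omega
      unfold brC4 at hc
      rw [e] at hc
      exact hc
    · left; rfl

/-- The TOP-LEVEL branch term with first chosen point `q'` (state: nothing chosen, no colour used). [this work] -/
def brTop (m σ q' : ℕ) : Bool :=
  brC4 σ m (krT5 σ m (fullN m)) (offM σ m) (offM σ m).toNat q' 0 0 0 0 0 0

/-- The DEPTH-TWO branch term: first point `q'` (colour `0`), second chosen point `q''`. [this work] -/
def brSnd (m σ q' q'' : ℕ) : Bool :=
  brC4 σ m (krT5 σ m (fullN m)) (offM σ m) (offM σ m).toNat q'' (0 ||| coneN m q') 1 (0 ||| belowN m q') 0 0 0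

/-- Depth two, colour branch `0`: the second point `q''` joins the colour of the first. [this work] -/
def sndCol0 (m σ q' q'' : ℕ) : Bool :=
  goC4 σ m (krT5 σ m (fullN m)) (offM σ m) (offM σ m).toNat (2 ^ m - (q'' + 1)) (q'' + 1) ((0 ||| coneN m q') ||| coneN m q'') 1
    ((0 ||| belowN m q') ||| belowN m q'') 0 0 0

/-- Depth two, colour branch `1`: the second point `q''` opens the second colour. [this work] -/
def sndCol1 (m σ q' q'' : ℕ) : Bool :=
  goC4 σ m (krT5 σ m (fullN m)) (offM σ m) (offM σ m).toNat (2 ^ m - (q'' + 1)) (q'' + 1) ((0 ||| coneN m q') ||| coneN m q'') 2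
    (0 ||| belowN m q') (0 ||| belowN m q'') 0 0

/-- A leaf with an empty colour class passes. [this work] -/
theorem leafT4_of_zero (σ m : ℕ) (F off : ℤ) (offN : ℕ) (d0 d2 d3 : ℕ) : leafT4 σ m F off offN d0 0 d2 d3 = true := by
  unfold leafT4
  rw [Bool.or_eq_true]
  exact Or.inl (decide_eq_true (Or.inr (Or.inl rfl)))

/-- **`colourCheck4` from the top-level branch terms.** [this work] -/
theorem colourCheck4_of_brTop {m σ : ℕ} (hσ : 0 < σ) (hb : 24 * 16 ^ m < 2 ^ (σ - 1))
    (hch : ∀ q', q' < 2 ^ m → brTop m σ q' = true) : colourCheck4 m σ = true := by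
  unfold colourCheck4
  simp only [Bool.and_eq_true, decide_eq_true_eq]
  exact ⟨⟨hσ, hb⟩, goC4_of_chain σ m _ _ _ 0 0 0 0 0 0 (2 ^ m) 0 (by simp) (fun q' _ h _ => hch q' h)
    (leafT4_of_zero σ m _ _ _ 0 0 0)⟩

/-- **A top-level branch term from its depth-two branch terms** (second points `q'' > q'` incomparable with `q'`). [this work] -/
theorem brTop_of_brSnd {m σ q' : ℕ} (hq' : q' < 2 ^ m)
    (hch : ∀ q'', q' < q'' → q'' < 2 ^ m → (0 ||| coneN m q').testBit q'' = false → brSnd m σ q' q'' = true) :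
    brTop m σ q' = true := by
  unfold brTop brC4
  simp only [Bool.and_eq_true, Bool.or_eq_true, decide_eq_true_eq]
  refine ⟨⟨⟨?_, Or.inl zero_lt_one⟩, Or.inl (by norm_num)⟩, Or.inl (by norm_num)⟩
  exact goC4_of_chain σ m _ _ _ _ 1 _ 0 0 0 (2 ^ m - (q' + 1)) (q' + 1) (by omega)
    (fun q'' h1 h2 h3 => hch q'' (by omega) h2 h3) (leafT4_of_zero σ m _ _ _ _ 0 0)

/-- **A depth-two branch term from its two colour branches.** [this work] -/
theorem brSnd_of_sndCol {m σ q' q'' : ℕ} (h0 : sndCol0 m σ q' q'' = true) (h1 : sndCol1 m σ q' q'' = true) :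
    brSnd m σ q' q'' = true := by
  unfold brSnd brC4
  unfold sndCol0 at h0
  unfold sndCol1 at h1
  simp only [Bool.and_eq_true, Bool.or_eq_true, decide_eq_true_eq]
  exact ⟨⟨⟨h0, Or.inr h1⟩, Or.inl (by norm_num)⟩, Or.inl (by norm_num)⟩

/-! ## Completeness of the recursion, up to relabelling of the colours -/

/-- **Soundness of `goC4`**: if the recursion from point `q` with state `(forb, nc, d)` passes, then for every set `E` of points `≥ q` avoiding
`forb` and pairwise incomparable, and every colouring `c`, some relabelling `π ∈ S₄` of the colours fixing the `nc` colours already in use makes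
the leaf of the masks `d_i` joined with the coloured down-sets of `E` (colouring `π ∘ c`) pass. [this work] -/
theorem goC4_sound (σ m : ℕ) (F off : ℤ) (offN : ℕ) :
    ∀ (fuel q forb nc d0 d1 d2 d3 : ℕ), q + fuel = 2 ^ m → goC4 σ m F off offN fuel q forb nc d0 d1 d2 d3 = true →
      ∀ E : Finset ℕ, (∀ x ∈ E, q ≤ x ∧ x < 2 ^ m) → (∀ x ∈ E, forb.testBit x = false) →
        (∀ x ∈ E, ∀ y ∈ E, x ≠ y → x &&& y ≠ x) → ∀ c : ℕ → Fin 4,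
        ∃ π : Equiv.Perm (Fin 4), (∀ i : Fin 4, (i : ℕ) < nc → π i = i) ∧
          leafT4 σ m F off offN (d0 ||| downMask4 m E (fun x => π (c x)) 0) (d1 ||| downMask4 m E (fun x => π (c x)) 1)
            (d2 ||| downMask4 m E (fun x => π (c x)) 2) (d3 ||| downMask4 m E (fun x => π (c x)) 3) = true := by
  intro fuel
  induction fuel with
  | zero =>
    intro q forb nc d0 d1 d2 d3 hq h E hE _ _ c
    have hE0 : E = ∅ := by
      refine eq_empty_of_forall_notMem fun x hx => ?_
      have := hE x hx
      omega
    subst hE0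
    refine ⟨1, fun _ _ => rfl, ?_⟩
    rw [lor_downMask4_empty, lor_downMask4_empty, lor_downMask4_empty, lor_downMask4_empty]
    exact h
  | succ fuel ih =>
    intro q forb nc d0 d1 d2 d3 hq h E hE hforb hanti c
    unfold goC4 at h
    simp only [Bool.and_eq_true, Bool.or_eq_true, decide_eq_true_eq] at h
    obtain ⟨hskip, hbranch⟩ := h
    have hq' : q + 1 + fuel = 2 ^ m := by omega
    by_cases hqE : q ∈ E
    · -- include `q`
      have hfq : forb.testBit q = false := hforb q hqE
      rcases hbranch with hf | ⟨⟨⟨h0, g1⟩, g2⟩, g3⟩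
      · rw [hfq] at hf; exact absurd hf Bool.false_ne_true
      -- hypotheses for `E.erase q` from `q + 1` with the enlarged exclusion mask
      have hE' : ∀ x ∈ E.erase q, q + 1 ≤ x ∧ x < 2 ^ m := by
        intro x hx
        obtain ⟨hxq, hxE⟩ := mem_erase.1 hx
        have := hE x hxE
        omega
      have hforb' : ∀ x ∈ E.erase q, (forb ||| coneN m q).testBit x = false := by
        intro x hx
        obtain ⟨hxq, hxE⟩ := mem_erase.1 hx
        rw [Nat.testBit_lor, hforb x hxE, Bool.false_or, testBit_coneN]
        have h1 : x &&& q ≠ x := hanti x hxE q hqE hxq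
        have h2 : q &&& x ≠ q := hanti q hqE x hxE (Ne.symm hxq)
        simp [h1, h2]
      have hanti' : ∀ x ∈ E.erase q, ∀ y ∈ E.erase q, x ≠ y → x &&& y ≠ x :=
        fun x hx y hy hxy => hanti x (mem_of_mem_erase hx) y (mem_of_mem_erase hy) hxy
      -- the branch to follow (`i₀`) and the relabelling `τ` sending the colour of `q` to it
      obtain ⟨i₀, τ, hi₀, hτfix, hτq⟩ : ∃ (i₀ : Fin 4) (τ : Equiv.Perm (Fin 4)),
          (i₀ : ℕ) ≤ nc ∧ (∀ i : Fin 4, (i : ℕ) < nc → τ i = i) ∧ τ (c q) = i₀ := by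
        by_cases hj : ((c q : Fin 4) : ℕ) < nc
        · exact ⟨c q, 1, le_of_lt hj, fun _ _ => rfl, rfl⟩
        · have hlt : nc < 4 := lt_of_le_of_lt (not_lt.1 hj) (c q).isLt
          refine ⟨⟨nc, hlt⟩, Equiv.swap ⟨nc, hlt⟩ (c q), le_rfl, fun i hi => ?_, Equiv.swap_apply_right _ _⟩
          refine Equiv.swap_apply_of_ne_of_ne ?_ ?_
          · intro h; rw [h] at hi; exact lt_irrefl _ hi
          · intro h; rw [h] at hi; exact hj hi
      -- the explored branch `i₀`
      have hb : goC4 σ m F off offN fuel (q + 1) (forb ||| coneN m q) (max nc ((i₀ : ℕ) + 1))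
          (if i₀ = 0 then d0 ||| belowN m q else d0) (if i₀ = 1 then d1 ||| belowN m q else d1)
          (if i₀ = 2 then d2 ||| belowN m q else d2) (if i₀ = 3 then d3 ||| belowN m q else d3) = true := by
        have hi₀' := hi₀
        fin_cases i₀
        · simpa using h0
        · rcases g1 with g | g
          · exact absurd g (by simp at hi₀'; omega)
          · simpa using g
        · rcases g2 with g | g
          · exact absurd g (by simp at hi₀'; omega)
          · simpa using g
        · rcases g3 with g | g
          · exact absurd g (by simp at hi₀'; omega)
          · simpa using g
      obtain ⟨π', hπ'fix, hleaf⟩ := ih (q + 1) _ _ _ _ _ _ hq' hb (E.erase q) hE' hforb' hanti' (fun x => τ (c x))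
      refine ⟨τ.trans π', fun i hi => ?_, ?_⟩
      · rw [Equiv.trans_apply, hτfix i hi, hπ'fix i (lt_of_lt_of_le hi (le_max_left _ _))]
      · have hcq : (fun x => π' (τ (c x))) q = i₀ := by
          show π' (τ (c q)) = i₀
          rw [hτq]
          exact hπ'fix i₀ (lt_of_lt_of_le (Nat.lt_succ_self _) (le_max_right _ _))
        rw [step_mask4 m d0 E _ hqE i₀ 0 hcq, step_mask4 m d1 E _ hqE i₀ 1 hcq, step_mask4 m d2 E _ hqE i₀ 2 hcq,
          step_mask4 m d3 E _ hqE i₀ 3 hcq] at hleaf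
        exact hleaf
    · -- skip `q`
      refine ih (q + 1) forb nc d0 d1 d2 d3 hq' hskip E (fun x hx => ?_) hforb hanti c
      have := hE x hx
      have hxq : x ≠ q := fun h => hqE (h ▸ hx)
      omega

/-- **`colourCheck4` certifies, up to relabelling, every quadruple co-generated by a 4-coloured antichain of points.** [this work] -/
theorem leafT4_of_colourCheck4 {m σ : ℕ} (h : colourCheck4 m σ = true) (E : Finset ℕ) (c : ℕ → Fin 4)
    (hE : ∀ x ∈ E, x < 2 ^ m) (hanti : ∀ x ∈ E, ∀ y ∈ E, x ≠ y → x &&& y ≠ x) :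
    ∃ π : Equiv.Perm (Fin 4),
      leafT4 σ m (krT5 σ m (fullN m)) (offM σ m) (offM σ m).toNat (downMask4 m E (fun x => π (c x)) 0)
        (downMask4 m E (fun x => π (c x)) 1) (downMask4 m E (fun x => π (c x)) 2) (downMask4 m E (fun x => π (c x)) 3) = true := by
  unfold colourCheck4 at h
  simp only [Bool.and_eq_true, decide_eq_true_eq] at h
  obtain ⟨-, hgo⟩ := h
  obtain ⟨π, -, key⟩ := goC4_sound σ m (krT5 σ m (fullN m)) (offM σ m) (offM σ m).toNat (2 ^ m) 0 0 0 0 0 0 0 (by simp) hgo E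
    (fun x hx => ⟨Nat.zero_le _, hE x hx⟩) (fun x _ => Nat.zero_testBit x) hanti c
  have z : ∀ x : ℕ, 0 ||| x = x := fun x => Nat.eq_of_testBit_eq fun i => by simp
  rw [z, z, z, z] at key
  exact ⟨π, key⟩

end Summit.CriticalPhenomena.PercolationContinuityZ3.Theorems.SahiC4Cube
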